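import Literature.NumberTheory.Weil1964.UnitaryArchSingularCentralizerTopFormHaar        -- ★ A-p19: `archFrameEmbedding`, `centralizerMeasureOfFrame`, `archBlockDiag`
import Literature.NumberTheory.Rogawski1990.ArchSingularOrbitalIntegralProductPlaces      -- ★ `apply_mem_centralizer_iff_mem_pi_centralizer`, `archPiEquivCM_symm_circleDiagonal_eq_archDiagTorus`
import Literature.MeasureTheory.Group.InvariantQuotientPiNormalized                        -- ★ `subgroupPiCoords`, `subgroupPiHomeomorph`
import Literature.NumberTheory.Automorphic.ArchStableConjugacyLocalGlobal                 -- ★ `coe_archPiEquivCM_apply`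
import HarnessLib

/-!
# THE CENTRALISER FRAME MEASURE, PLACE BY PLACE: the frame measure of placewise-factorised block measures is the transport of the product of the LOCAL frame measures
# («(U)-ROAD» brick U3, generic part; Rogawski 1990 §1.7 «compatible measures», §3.8 Prop. 3.8.1 (a))

Topic `NumberTheory/Weil1964`; namespace `Literature.NumberTheory.Weil1964.UnitaryArchTopForm`.  THEOREMS ONLY (no `def`, no instance, no notation, no axiom, no named fact,
no `sorry`).  Cell `pub/hodgecm-mathlib`, ENGINE T1 (crux H413 = `stmt-HodgeConjecture-24833`); the (U) road (books row «(U)» = ★ `ArchSingularUniversalPinRatio`, LEAD F0P3a-plan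
(g10) T9-32 (4) ∕ T9-34 (2); MEMO «(U)-ROAD v0» F0P3-p03 (g11) 0f8ca2f389d5ab6c, brick U3; (b1) = A-p06 (g28) `archLocalTopFormHaar` + product theorem, read here as HYPOTHESES).
Count-neutral; HONEST LABEL: HC_CM is proved only modulo the printed citations until rung 0 closes; pure measure-theoretic bookkeeping, pays nothing by itself.

WHAT.  `L` CM, `γ ∈ U(J)(L⁺ ⊗ ℝ)` with a frame `T` (`σ(T)ᵀ J′ T = (J₁ ⊕ᶠ J₂)′`, `γ T = T (a·1 ⊕ᶠ b·1)`), local components `γ_w` (`e⁻¹ (γ_w)_w = γ`, `e = archPiEquivCM`), and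
per-place block measures `μ₁ w` on `U(σ_w J₁)(ℂ)`, `μ₂ w` on `U(σ_w J₂)(ℂ)`.  §1 dependent `(Π_w A_w × B_w) ≃ (Π_w A_w) × (Π_w B_w)` is measure preserving for product measures
(Mathlib's `measurePreserving_arrowProdEquivProdArrow`, dependent version); §2 the frame congruence READ AT A PLACE: `T_wᴴ σ_w(J) T_w = σ_w(J₁ ⊕ᶠ J₂)`, `γ_w T_w = T_w (a_w·1 ⊕ᶠ b_w·1)`
for `T_w = evalC_w(T)`; §3 the LOCAL frame map `u ↦ T_w (u₁ ⊕ᶠ u₂) T_w⁻¹ : U(σ_w J₁) × U(σ_w J₂) → Z(γ_w) ≤ U(σ_w J)(ℂ)` (★ generic `blockDiagFin`, ★ `conj_mem_unitaryGroupOfForm`), and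
the global frame embedding read at `w` IS it; §4 HEAD **`centralizerMeasureOfFrame_pi_eq_map_pi`**: `centralizerMeasureOfFrame T … (e₁⁻¹_* ⊗_w μ₁ w) (e₂⁻¹_* ⊗_w μ₂ w)` = the
transport to `Z(γ)` (★ `subgroupPiCoords` + ★ `subgroupCongrHomeomorph e⁻¹` — LITERALLY the `ρP ∕ ρ′` currency of ★ (D5) ∕ (W3-pins) ∕ (U)'s `hρP hρ′`) of `⊗_w θ_w`,
`θ_w := (local frame at w)_* (μ₁ w ⊗ μ₂ w)`.  With ★ `centralizerTopFormHaar_eq_centralizerMeasureOfFrame`, ★ (b5) placewise frames and (b1)'s product theorem this puts both sides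
of (U) in the same product currency; U5 is then a per-place comparison.

## References
* [Rogawski1990] J. D. Rogawski, *Automorphic Representations of Unitary Groups in Three Variables*, Ann. of Math. Stud. 123 (1990), §1.7 p. 6; §3.8 Prop. 3.8.1 (a) p. 27.
* [BorelJacquet1979] A. Borel, H. Jacquet, *Automorphic forms and automorphic representations*, PSPM 33.1 (1979), §4.1 (`G(F ⊗ ℝ) = ∏_v G(F_v)`).
* [DeitmarEchterhoff2014] A. Deitmar, S. Echterhoff, *Principles of Harmonic Analysis*, 2nd ed. (2014), Thm. 1.5.3 (product measures on product groups).
-/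

set_option autoImplicit false

noncomputable section

open NumberField NumberField.InfinitePlace NumberField.mixedEmbedding Set MeasureTheory MeasureTheory.Measure
open Literature.NumberTheory.Automorphic Literature.NumberTheory.Automorphic.UnitaryGroup Literature.NumberTheory.Rogawski1990
open Literature.MeasureTheory.Group
open scoped Matrix MatrixGroups ENNReal Classical

/-! ## §1 Dependent `(Π_w A_w × B_w) ≃ (Π_w A_w) × (Π_w B_w)` preserves product measures -/

namespace Literature.MeasureTheory.Group

/-- The unshuffle map `f ↦ (((f i).1)_i, ((f i).2)_i)` is measurable. [cite: DeitmarEchterhoff2014, Thm. 1.5.3] -/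
theorem measurable_unshuffle {ι : Type*} {A B : ι → Type*} [∀ i, MeasurableSpace (A i)] [∀ i, MeasurableSpace (B i)] :
    Measurable (fun f : ∀ i, A i × B i => ((fun i => (f i).1), (fun i => (f i).2))) :=
  (measurable_pi_lambda _ fun i => (measurable_pi_apply i).fst).prodMk (measurable_pi_lambda _ fun i => (measurable_pi_apply i).snd)

/-- **Unshuffling a product of products** (dependent version of Mathlib's `measurePreserving_arrowProdEquivProdArrow`): `(Π_i μ_i ⊗ ν_i)` is carried by
`f ↦ ((f i).1)_i, ((f i).2)_i` to `(Π_i μ_i) ⊗ (Π_i ν_i)`. [cite: DeitmarEchterhoff2014, Thm. 1.5.3] -/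
theorem map_unshuffle_pi_prod {ι : Type*} [Fintype ι] {A B : ι → Type*} [∀ i, MeasurableSpace (A i)] [∀ i, MeasurableSpace (B i)]
    (μ : ∀ i, Measure (A i)) (ν : ∀ i, Measure (B i)) [∀ i, SigmaFinite (μ i)] [∀ i, SigmaFinite (ν i)] :
    (Measure.pi fun i => (μ i).prod (ν i)).map (fun f : ∀ i, A i × B i => ((fun i => (f i).1), (fun i => (f i).2))) = (Measure.pi μ).prod (Measure.pi ν) := by
  classical
  have hmeas := measurable_unshuffle (A := A) (B := B)
  refine (FiniteSpanningSetsIn.ext ?_ (isPiSystem_pi.prod isPiSystem_pi)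
    ((FiniteSpanningSetsIn.pi fun i => (μ i).toFiniteSpanningSetsIn).prod (FiniteSpanningSetsIn.pi fun i => (ν i).toFiniteSpanningSetsIn)) ?_).symm
  · refine (generateFrom_eq_prod generateFrom_pi generateFrom_pi ?_ ?_).symm
    · exact (FiniteSpanningSetsIn.pi fun i => (μ i).toFiniteSpanningSetsIn).isCountablySpanning
    · exact (FiniteSpanningSetsIn.pi fun i => (ν i).toFiniteSpanningSetsIn).isCountablySpanning
  · rintro _ ⟨s, ⟨s, _, rfl⟩, ⟨_, ⟨t, _, rfl⟩, rfl⟩⟩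
    rw [Measure.map_apply hmeas ((MeasurableSet.univ_pi fun i => by measurability).prod (MeasurableSet.univ_pi fun i => by measurability))]
    · rw [show (fun f : ∀ i, A i × B i => ((fun i => (f i).1), (fun i => (f i).2))) ⁻¹' (univ.pi s ×ˢ univ.pi t) = univ.pi fun i => s i ×ˢ t i by
        ext; simp [Set.mem_pi, forall_and]]
      simp_rw [pi_pi, prod_prod, pi_pi, Finset.prod_mul_distrib]

end Literature.MeasureTheory.Group

namespace Literature.NumberTheory.Weil1964

namespace UnitaryArchTopForm

variable (L : Type) [Field L] [NumberField L] [IsCMField L]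

/-! ## §2 The frame congruence and the eigen-equation read at a place -/

section Place

variable {N : ℕ}

/-- **`σ(T)ᵀ J′ T = J₂′` READ AT A COMPLEX PLACE**: `T_wᴴ σ_w(J) T_w = σ_w(J₂)` for `T_w = evalC_w T` (★ `evalC_conjMixed`, ★ `archFormOf_map_evalC`). [cite: BorelJacquet1979, §4.1] -/
theorem formCongr_map_evalC_of_formCongr_archFormOf {T : GL (Fin N) (mixedSpace L)} {J J₂ : Matrix (Fin N) (Fin N) L}
    (hT : formCongr (conjMixed (↥(maximalRealSubfield L)) L (IsCMField.complexConj L)) T (archFormOf L N J) = archFormOf L N J₂) (w : {w : InfinitePlace L // IsComplex w}) :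
    formCongr (starRingEnd ℂ) (Matrix.GeneralLinearGroup.map (evalC L w) T) (J.map w.1.embedding) = J₂.map w.1.embedding := by
  have hc := IsCMField.complexConj_ne_one L
  have hfix := complexConj_smul_infinitePlace L
  have e := congrArg (fun M : Matrix (Fin N) (Fin N) (mixedSpace L) => M.map (evalC L w)) hT
  rw [archFormOf_map_evalC, formCongr, Matrix.map_mul, Matrix.map_mul, archFormOf_map_evalC, Matrix.transpose_map, Matrix.map_map] at e
  have hcomp : (⇑(evalC L w) ∘ ⇑(conjMixed (↥(maximalRealSubfield L)) L (IsCMField.complexConj L)) : mixedSpace L → ℂ) = ⇑(starRingEnd ℂ) ∘ ⇑(evalC L w) :=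
    funext fun x => evalC_conjMixed (↥(maximalRealSubfield L)) L (IsCMField.complexConj L) (hfix w.1) hc x
  rw [hcomp, ← Matrix.map_map] at e
  exact e

omit [NumberField L] [IsCMField L] in
/-- The matrix of `GL_N(evalC w) g` is the entrywise `evalC w` of the matrix of `g`. [folklore] -/
private theorem coe_map_evalC (g : GL (Fin N) (mixedSpace L)) (w : {w : InfinitePlace L // IsComplex w}) :
    ((Matrix.GeneralLinearGroup.map (evalC L w) g : GL (Fin N) ℂ) : Matrix (Fin N) (Fin N) ℂ) = (g : Matrix (Fin N) (Fin N) (mixedSpace L)).map (evalC L w) := rfl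

omit [NumberField L] [IsCMField L] in
/-- **`γ T = T (a·1 ⊕ᶠ b·1)` READ AT A COMPLEX PLACE**: `γ_w T_w = T_w (a_w·1 ⊕ᶠ b_w·1)`. [cite: Rogawski1990, §3.8 Prop. 3.8.1 (a) p. 27] -/
theorem mul_eq_map_evalC_of_mul_eq {N₁ N₂ : ℕ} {T : GL (Fin (N₁ + N₂)) (mixedSpace L)} {a b : mixedSpace L} {γ : GL (Fin (N₁ + N₂)) (mixedSpace L)}
    (hγ : (γ : Matrix (Fin (N₁ + N₂)) (Fin (N₁ + N₂)) (mixedSpace L)) * (T : Matrix (Fin (N₁ + N₂)) (Fin (N₁ + N₂)) (mixedSpace L)) =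
      (T : Matrix (Fin (N₁ + N₂)) (Fin (N₁ + N₂)) (mixedSpace L)) * finSum N₁ N₂ (a • (1 : Matrix (Fin N₁) (Fin N₁) (mixedSpace L))) (b • 1))
    (w : {w : InfinitePlace L // IsComplex w}) :
    ((Matrix.GeneralLinearGroup.map (evalC L w) γ : GL (Fin (N₁ + N₂)) ℂ) : Matrix (Fin (N₁ + N₂)) (Fin (N₁ + N₂)) ℂ) *
        ((Matrix.GeneralLinearGroup.map (evalC L w) T : GL (Fin (N₁ + N₂)) ℂ) : Matrix (Fin (N₁ + N₂)) (Fin (N₁ + N₂)) ℂ) =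
      ((Matrix.GeneralLinearGroup.map (evalC L w) T : GL (Fin (N₁ + N₂)) ℂ) : Matrix (Fin (N₁ + N₂)) (Fin (N₁ + N₂)) ℂ) *
        finSum N₁ N₂ (evalC L w a • (1 : Matrix (Fin N₁) (Fin N₁) ℂ)) (evalC L w b • 1) := by
  have e := congrArg (fun M : Matrix (Fin (N₁ + N₂)) (Fin (N₁ + N₂)) (mixedSpace L) => M.map (evalC L w)) hγ
  rw [Matrix.map_mul, Matrix.map_mul, finSum_map, Matrix.map_smul' _ _ _ (map_mul (evalC L w)), Matrix.map_smul' _ _ _ (map_mul (evalC L w)),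
    Matrix.map_one (evalC L w) (map_zero _) (map_one _), Matrix.map_one (evalC L w) (map_zero _) (map_one _)] at e
  exact e

end Place

/-! ## §3 The local frame map at a place -/

section LocalFrame

variable {N₁ N₂ : ℕ} {J : Matrix (Fin (N₁ + N₂)) (Fin (N₁ + N₂)) L} {J₁ : Matrix (Fin N₁) (Fin N₁) L} {J₂ : Matrix (Fin N₂) (Fin N₂) L}
  (w : {w : InfinitePlace L // IsComplex w}) {Tw : GL (Fin (N₁ + N₂)) ℂ}
  (hTw : formCongr (starRingEnd ℂ) Tw (J.map w.1.embedding) = (finSum N₁ N₂ J₁ J₂).map w.1.embedding)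

omit [NumberField L] [IsCMField L] in
include hTw in
/-- **The local frame conjugate lands in `U(σ_w J)(ℂ)`**: `T_w (u₁ ⊕ᶠ u₂) T_w⁻¹ ∈ archLocal L (N₁+N₂) J w` for `u_i ∈ U(σ_w J_i)(ℂ)` (★ `blockDiagFin`, ★ `conj_mem_unitaryGroupOfForm`).
[cite: Rogawski1990, §3.8 Prop. 3.8.1 (a) p. 27] -/
theorem conj_blockDiagFin_mem_archLocal (u : archLocal L N₁ J₁ w × archLocal L N₂ J₂ w) :
    Tw * ((blockDiagFin (starRingEnd ℂ) (J₁.map w.1.embedding) (J₂.map w.1.embedding) u : unitaryGroupOfForm (starRingEnd ℂ) (finSum N₁ N₂ (J₁.map w.1.embedding) (J₂.map w.1.embedding))) :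
        GL (Fin (N₁ + N₂)) ℂ) * Tw⁻¹ ∈ archLocal L (N₁ + N₂) J w := by
  refine conj_mem_unitaryGroupOfForm (starRingEnd ℂ) Tw (J.map w.1.embedding) ?_
  rw [hTw, finSum_map]
  exact (blockDiagFin (starRingEnd ℂ) (J₁.map w.1.embedding) (J₂.map w.1.embedding) u).2

omit [NumberField L] [IsCMField L] in
include hTw in
/-- **The local frame conjugate commutes with `γ_w`** whenever `γ_w T_w = T_w (a·1 ⊕ᶠ b·1)` (block-diagonal matrices commute with block scalars, ★ `finSum_commute_finSum_smul_one`;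
the computation of ★ `archFrameEmbedding_mem_centralizer`, verbatim over `ℂ`). [cite: Rogawski1990, §3.8 Prop. 3.8.1 (a) p. 27] -/
theorem conj_blockDiagFin_mem_centralizer (γw : archLocal L (N₁ + N₂) J w) {a b : ℂ}
    (hγw : ((γw : GL (Fin (N₁ + N₂)) ℂ) : Matrix (Fin (N₁ + N₂)) (Fin (N₁ + N₂)) ℂ) * (Tw : Matrix (Fin (N₁ + N₂)) (Fin (N₁ + N₂)) ℂ) =
      (Tw : Matrix (Fin (N₁ + N₂)) (Fin (N₁ + N₂)) ℂ) * finSum N₁ N₂ (a • (1 : Matrix (Fin N₁) (Fin N₁) ℂ)) (b • 1))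
    (u : archLocal L N₁ J₁ w × archLocal L N₂ J₂ w) :
    (⟨Tw * ((blockDiagFin (starRingEnd ℂ) (J₁.map w.1.embedding) (J₂.map w.1.embedding) u : unitaryGroupOfForm (starRingEnd ℂ) (finSum N₁ N₂ (J₁.map w.1.embedding) (J₂.map w.1.embedding))) :
        GL (Fin (N₁ + N₂)) ℂ) * Tw⁻¹, conj_blockDiagFin_mem_archLocal L w hTw u⟩ : archLocal L (N₁ + N₂) J w) ∈
      Subgroup.centralizer ({γw} : Set (archLocal L (N₁ + N₂) J w)) := by
  rw [Subgroup.mem_centralizer_iff]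
  intro k hk
  rw [Set.mem_singleton_iff] at hk
  rw [hk]
  apply Subtype.ext
  apply Units.ext
  set Tm : Matrix (Fin (N₁ + N₂)) (Fin (N₁ + N₂)) ℂ := (Tw : Matrix (Fin (N₁ + N₂)) (Fin (N₁ + N₂)) ℂ) with hTm
  set Ti : Matrix (Fin (N₁ + N₂)) (Fin (N₁ + N₂)) ℂ := ((Tw⁻¹ : GL (Fin (N₁ + N₂)) ℂ) : Matrix (Fin (N₁ + N₂)) (Fin (N₁ + N₂)) ℂ) with hTi
  have hTT : Tm * Ti = 1 := by rw [hTm, hTi, ← Units.val_mul, mul_inv_cancel, Units.val_one]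
  have hTT' : Ti * Tm = 1 := by rw [hTm, hTi, ← Units.val_mul, inv_mul_cancel, Units.val_one]
  set D := finSum N₁ N₂ (a • (1 : Matrix (Fin N₁) (Fin N₁) ℂ)) (b • 1) with hD
  set B := (((blockDiagFin (starRingEnd ℂ) (J₁.map w.1.embedding) (J₂.map w.1.embedding) u : unitaryGroupOfForm (starRingEnd ℂ) (finSum N₁ N₂ (J₁.map w.1.embedding) (J₂.map w.1.embedding))) :
    GL (Fin (N₁ + N₂)) ℂ) : Matrix (Fin (N₁ + N₂)) (Fin (N₁ + N₂)) ℂ) with hB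
  have hBD : B * D = D * B :=
    finSum_commute_finSum_smul_one a b ((u.1 : GL (Fin N₁) ℂ) : Matrix (Fin N₁) (Fin N₁) ℂ) ((u.2 : GL (Fin N₂) ℂ) : Matrix (Fin N₂) (Fin N₂) ℂ)
  have hγ' : ((γw : GL (Fin (N₁ + N₂)) ℂ) : Matrix (Fin (N₁ + N₂)) (Fin (N₁ + N₂)) ℂ) = Tm * D * Ti := by
    rw [← hγw, Matrix.mul_assoc, hTT, Matrix.mul_one]
  change ((γw : GL (Fin (N₁ + N₂)) ℂ) : Matrix (Fin (N₁ + N₂)) (Fin (N₁ + N₂)) ℂ) * (Tm * B * Ti) =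
    (Tm * B * Ti) * ((γw : GL (Fin (N₁ + N₂)) ℂ) : Matrix (Fin (N₁ + N₂)) (Fin (N₁ + N₂)) ℂ)
  rw [hγ']
  calc Tm * D * Ti * (Tm * B * Ti) = Tm * D * (Ti * Tm) * B * Ti := by simp only [Matrix.mul_assoc]
    _ = Tm * (D * B) * Ti := by rw [hTT', Matrix.mul_one]; simp only [Matrix.mul_assoc]
    _ = Tm * (B * D) * Ti := by rw [hBD]
    _ = Tm * B * (Ti * Tm) * D * Ti := by rw [hTT', Matrix.mul_one]; simp only [Matrix.mul_assoc]
    _ = Tm * B * Ti * (Tm * D * Ti) := by simp only [Matrix.mul_assoc]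

end LocalFrame

/-! ## §4 The global frame embedding read at a place -/

section Global

variable {N₁ N₂ : ℕ} {J : Matrix (Fin (N₁ + N₂)) (Fin (N₁ + N₂)) L} {J₁ : Matrix (Fin N₁) (Fin N₁) L} {J₂ : Matrix (Fin N₂) (Fin N₂) L}

/-- **The frame embedding read at a place**: `evalC_w (T (u₁ ⊕ᶠ u₂) T⁻¹) = T_w ((u₁)_w ⊕ᶠ (u₂)_w) T_w⁻¹` in `GL_{N₁+N₂}(ℂ)` (★ `coe_archFrameEmbedding`, ★ `coe_blockDiagFin`, ★ `finSum_map`).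
[cite: BorelJacquet1979, §4.1] [cite: Rogawski1990, §3.8 Prop. 3.8.1 (a) p. 27] -/
theorem map_evalC_archFrameEmbedding (T : GL (Fin (N₁ + N₂)) (mixedSpace L))
    (hT : formCongr (conjMixed (↥(maximalRealSubfield L)) L (IsCMField.complexConj L)) T (archFormOf L (N₁ + N₂) J) = archFormOf L (N₁ + N₂) (finSum N₁ N₂ J₁ J₂))
    (u : arch (↥(maximalRealSubfield L)) L (IsCMField.complexConj L) N₁ J₁ × arch (↥(maximalRealSubfield L)) L (IsCMField.complexConj L) N₂ J₂)
    (w : {w : InfinitePlace L // IsComplex w}) :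
    Matrix.GeneralLinearGroup.map (evalC L w) ((archFrameEmbedding T hT u : arch (↥(maximalRealSubfield L)) L (IsCMField.complexConj L) (N₁ + N₂) J) : GL (Fin (N₁ + N₂)) (mixedSpace L)) =
      Matrix.GeneralLinearGroup.map (evalC L w) T *
        ((blockDiagFin (starRingEnd ℂ) (J₁.map w.1.embedding) (J₂.map w.1.embedding) (archPiEquivCM N₁ L J₁ u.1 w, archPiEquivCM N₂ L J₂ u.2 w) :
            unitaryGroupOfForm (starRingEnd ℂ) (finSum N₁ N₂ (J₁.map w.1.embedding) (J₂.map w.1.embedding))) : GL (Fin (N₁ + N₂)) ℂ) *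
        (Matrix.GeneralLinearGroup.map (evalC L w) T)⁻¹ := by
  rw [coe_archFrameEmbedding, map_mul, map_mul, map_inv]
  congr 1; congr 1
  apply Units.ext
  rw [coe_map_evalC, coe_coe_archBlockDiag, finSum_map]
  rfl

/-- Local components of `γ`: `(γloc w) = evalC_w γ` in `GL` when `e⁻¹ γloc = γ`. [cite: BorelJacquet1979, §4.1] -/
theorem coe_eq_map_evalC_of_archPiEquivCM_symm_eq {N : ℕ} {J : Matrix (Fin N) (Fin N) L} {γloc : ∀ w : {w : InfinitePlace L // IsComplex w}, archLocal L N J w}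
    {γ : arch (↥(maximalRealSubfield L)) L (IsCMField.complexConj L) N J} (hγloc : (archPiEquivCM N L J).symm γloc = γ) (w : {w : InfinitePlace L // IsComplex w}) :
    ((γloc w : archLocal L N J w) : GL (Fin N) ℂ) = Matrix.GeneralLinearGroup.map (evalC L w) (γ : GL (Fin N) (mixedSpace L)) := by
  rw [← hγloc, ← coe_archPiEquivCM_apply, ContinuousMulEquiv.apply_symm_apply]

end Global

/-! ## §5 The frame measure of placewise-factorised block measures -/

section Product

variable {N₁ N₂ : ℕ} {J : Matrix (Fin (N₁ + N₂)) (Fin (N₁ + N₂)) L} {J₁ : Matrix (Fin N₁) (Fin N₁) L} {J₂ : Matrix (Fin N₂) (Fin N₂) L}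
  [MeasurableSpace (GL (Fin (N₁ + N₂)) ℂ)] [BorelSpace (GL (Fin (N₁ + N₂)) ℂ)] [MeasurableSpace (GL (Fin N₁) ℂ)] [BorelSpace (GL (Fin N₁) ℂ)]
  [MeasurableSpace (GL (Fin N₂) ℂ)] [BorelSpace (GL (Fin N₂) ℂ)]
  [MeasurableSpace (arch (↥(maximalRealSubfield L)) L (IsCMField.complexConj L) N₁ J₁)] [BorelSpace (arch (↥(maximalRealSubfield L)) L (IsCMField.complexConj L) N₁ J₁)] [MeasurableSpace (arch (↥(maximalRealSubfield L)) L (IsCMField.complexConj L) N₂ J₂)] [BorelSpace (arch (↥(maximalRealSubfield L)) L (IsCMField.complexConj L) N₂ J₂)]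
  [MeasurableSpace (arch (↥(maximalRealSubfield L)) L (IsCMField.complexConj L) (N₁ + N₂) J)] [BorelSpace (arch (↥(maximalRealSubfield L)) L (IsCMField.complexConj L) (N₁ + N₂) J)]

/-- **THE CENTRALISER FRAME MEASURE, PLACE BY PLACE.**  For a frame `T` of `γ ∈ U(J)(L⁺ ⊗ ℝ)` (`σ(T)ᵀ J′ T = (J₁ ⊕ᶠ J₂)′`, `γ T = T (a·1 ⊕ᶠ b·1)`), local components `γloc w` of `γ`
(`e⁻¹ γloc = γ`), and per-place σ-finite block measures `μ₁ w`, `μ₂ w`: the frame measure of the transported products `e₁⁻¹_* ⊗_w μ₁ w`, `e₂⁻¹_* ⊗_w μ₂ w` (★ `centralizerMeasureOfFrame`)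
IS the transport to `Z(γ)` — through ★ `subgroupPiCoords` and ★ `subgroupCongrHomeomorph e⁻¹`, the `ρP ∕ ρ′` currency of ★ (D5)∕(W3-pins)∕(U) — of the product `⊗_w θ_w` of the
LOCAL frame measures `θ_w := (u ↦ T_w (u₁ ⊕ᶠ u₂) T_w⁻¹)_* (μ₁ w ⊗ μ₂ w)` on the local centralisers `Z(γ_w) ≤ U(σ_w J)(ℂ)`.
[cite: Rogawski1990, §1.7 p. 6; §3.8 Prop. 3.8.1 (a) p. 27] [cite: BorelJacquet1979, §4.1] [cite: DeitmarEchterhoff2014, Thm. 1.5.3] -/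
theorem centralizerMeasureOfFrame_pi_eq_map_pi (T : GL (Fin (N₁ + N₂)) (mixedSpace L))
    (hT : formCongr (conjMixed (↥(maximalRealSubfield L)) L (IsCMField.complexConj L)) T (archFormOf L (N₁ + N₂) J) = archFormOf L (N₁ + N₂) (finSum N₁ N₂ J₁ J₂))
    {a b : mixedSpace L} (γ : arch (↥(maximalRealSubfield L)) L (IsCMField.complexConj L) (N₁ + N₂) J)
    (hγ : ((γ : GL (Fin (N₁ + N₂)) (mixedSpace L)) : Matrix (Fin (N₁ + N₂)) (Fin (N₁ + N₂)) (mixedSpace L)) * (T : Matrix (Fin (N₁ + N₂)) (Fin (N₁ + N₂)) (mixedSpace L)) =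
      (T : Matrix (Fin (N₁ + N₂)) (Fin (N₁ + N₂)) (mixedSpace L)) * finSum N₁ N₂ (a • (1 : Matrix (Fin N₁) (Fin N₁) (mixedSpace L))) (b • 1))
    (γloc : ∀ w : {w : InfinitePlace L // IsComplex w}, archLocal L (N₁ + N₂) J w) (hγloc : (archPiEquivCM (N₁ + N₂) L J).symm γloc = γ)
    (μ₁ : ∀ w : {w : InfinitePlace L // IsComplex w}, Measure (archLocal L N₁ J₁ w)) (μ₂ : ∀ w : {w : InfinitePlace L // IsComplex w}, Measure (archLocal L N₂ J₂ w))
    [∀ w, SigmaFinite (μ₁ w)] [∀ w, SigmaFinite (μ₂ w)]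
    (θ : ∀ w : {w : InfinitePlace L // IsComplex w}, Measure (Subgroup.centralizer ({γloc w} : Set (archLocal L (N₁ + N₂) J w)))) [∀ w, SigmaFinite (θ w)]
    (hθ : ∀ w, θ w = ((μ₁ w).prod (μ₂ w)).map (fun u : archLocal L N₁ J₁ w × archLocal L N₂ J₂ w =>
      (⟨⟨Matrix.GeneralLinearGroup.map (evalC L w) T *
          ((blockDiagFin (starRingEnd ℂ) (J₁.map w.1.embedding) (J₂.map w.1.embedding) u : unitaryGroupOfForm (starRingEnd ℂ) (finSum N₁ N₂ (J₁.map w.1.embedding) (J₂.map w.1.embedding))) : GL (Fin (N₁ + N₂)) ℂ) *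
          (Matrix.GeneralLinearGroup.map (evalC L w) T)⁻¹, conj_blockDiagFin_mem_archLocal L w (formCongr_map_evalC_of_formCongr_archFormOf L hT w) u⟩,
        conj_blockDiagFin_mem_centralizer L w (formCongr_map_evalC_of_formCongr_archFormOf L hT w) (γloc w)
          (by rw [coe_eq_map_evalC_of_archPiEquivCM_symm_eq L hγloc w]; exact mul_eq_map_evalC_of_mul_eq L hγ w) u⟩ :
        Subgroup.centralizer ({γloc w} : Set (archLocal L (N₁ + N₂) J w))))) :
    centralizerMeasureOfFrame T hT γ hγ ((Measure.pi μ₁).map (archPiEquivCM N₁ L J₁).symm) ((Measure.pi μ₂).map (archPiEquivCM N₂ L J₂).symm) =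
      ((Measure.pi θ).map (subgroupPiCoords fun w : {w : InfinitePlace L // IsComplex w} => Subgroup.centralizer ({γloc w} : Set (archLocal L (N₁ + N₂) J w))).symm).map
        (subgroupCongrHomeomorph ((archPiEquivCM (N₁ + N₂) L J).symm.toMulEquiv : (∀ w : {w : InfinitePlace L // IsComplex w}, archLocal L (N₁ + N₂) J w) ≃* arch (↥(maximalRealSubfield L)) L (IsCMField.complexConj L) (N₁ + N₂) J)
          (Subgroup.pi Set.univ fun w : {w : InfinitePlace L // IsComplex w} => Subgroup.centralizer ({γloc w} : Set (archLocal L (N₁ + N₂) J w)))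
          (Subgroup.centralizer ({γ} : Set (arch (↥(maximalRealSubfield L)) L (IsCMField.complexConj L) (N₁ + N₂) J)))
          (apply_mem_centralizer_iff_mem_pi_centralizer _ (archPiEquivCM (N₁ + N₂) L J).symm.toMulEquiv hγloc)
          (archPiEquivCM (N₁ + N₂) L J).symm.continuous (archPiEquivCM (N₁ + N₂) L J).continuous) := by
  classical
  haveI : ∀ w : {w : InfinitePlace L // IsComplex w}, SecondCountableTopology (archLocal L N₁ J₁ w) := fun w => secondCountableTopology_archLocal L N₁ J₁ w
  haveI : ∀ w : {w : InfinitePlace L // IsComplex w}, SecondCountableTopology (archLocal L N₂ J₂ w) := fun w => secondCountableTopology_archLocal L N₂ J₂ w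
  haveI : ∀ w : {w : InfinitePlace L // IsComplex w}, SecondCountableTopology (archLocal L (N₁ + N₂) J w) := fun w => secondCountableTopology_archLocal L (N₁ + N₂) J w
  -- name the maps
  set lam : ∀ w : {w : InfinitePlace L // IsComplex w}, archLocal L N₁ J₁ w × archLocal L N₂ J₂ w → Subgroup.centralizer ({γloc w} : Set (archLocal L (N₁ + N₂) J w)) :=
    fun w => fun u : archLocal L N₁ J₁ w × archLocal L N₂ J₂ w =>
      (⟨⟨Matrix.GeneralLinearGroup.map (evalC L w) T *
          ((blockDiagFin (starRingEnd ℂ) (J₁.map w.1.embedding) (J₂.map w.1.embedding) u : unitaryGroupOfForm (starRingEnd ℂ) (finSum N₁ N₂ (J₁.map w.1.embedding) (J₂.map w.1.embedding))) : GL (Fin (N₁ + N₂)) ℂ) *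
          (Matrix.GeneralLinearGroup.map (evalC L w) T)⁻¹, conj_blockDiagFin_mem_archLocal L w (formCongr_map_evalC_of_formCongr_archFormOf L hT w) u⟩,
        conj_blockDiagFin_mem_centralizer L w (formCongr_map_evalC_of_formCongr_archFormOf L hT w) (γloc w)
          (by rw [coe_eq_map_evalC_of_archPiEquivCM_symm_eq L hγloc w]; exact mul_eq_map_evalC_of_mul_eq L hγ w) u⟩ :
        Subgroup.centralizer ({γloc w} : Set (archLocal L (N₁ + N₂) J w))) with hlamdef
  set sc := subgroupCongrHomeomorph ((archPiEquivCM (N₁ + N₂) L J).symm.toMulEquiv : (∀ w : {w : InfinitePlace L // IsComplex w}, archLocal L (N₁ + N₂) J w) ≃* arch (↥(maximalRealSubfield L)) L (IsCMField.complexConj L) (N₁ + N₂) J)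
      (Subgroup.pi Set.univ fun w : {w : InfinitePlace L // IsComplex w} => Subgroup.centralizer ({γloc w} : Set (archLocal L (N₁ + N₂) J w)))
      (Subgroup.centralizer ({γ} : Set (arch (↥(maximalRealSubfield L)) L (IsCMField.complexConj L) (N₁ + N₂) J)))
      (apply_mem_centralizer_iff_mem_pi_centralizer _ (archPiEquivCM (N₁ + N₂) L J).symm.toMulEquiv hγloc)
      (archPiEquivCM (N₁ + N₂) L J).symm.continuous (archPiEquivCM (N₁ + N₂) L J).continuous with hscdef
  set Φ : arch (↥(maximalRealSubfield L)) L (IsCMField.complexConj L) N₁ J₁ × arch (↥(maximalRealSubfield L)) L (IsCMField.complexConj L) N₂ J₂ → Subgroup.centralizer ({γ} : Set (arch (↥(maximalRealSubfield L)) L (IsCMField.complexConj L) (N₁ + N₂) J)) :=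
    fun u => ⟨archFrameEmbedding T hT u, archFrameEmbedding_mem_centralizer T hT γ hγ u⟩ with hΦdef
  -- measurability
  have hΦm : Measurable Φ := ((continuous_archFrameEmbedding T hT).subtype_mk _).measurable
  have hm₁ : Measurable ⇑(archPiEquivCM N₁ L J₁).symm := (archPiEquivCM N₁ L J₁).symm.continuous.measurable
  have hm₂ : Measurable ⇑(archPiEquivCM N₂ L J₂).symm := (archPiEquivCM N₂ L J₂).symm.continuous.measurable
  have hPm : Measurable (Prod.map ⇑(archPiEquivCM N₁ L J₁).symm ⇑(archPiEquivCM N₂ L J₂).symm) := hm₁.prodMap hm₂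
  have hlamc : ∀ w : {w : InfinitePlace L // IsComplex w}, Continuous (lam w) := fun w =>
    ((continuous_const.mul (continuous_subtype_val.comp (continuous_blockDiagFin (starRingEnd ℂ) _ _))).mul continuous_const).subtype_mk _ |>.subtype_mk _
  have hlam : ∀ w : {w : InfinitePlace L // IsComplex w}, Measurable (lam w) := fun w => (hlamc w).measurable
  have hΛm : Measurable (fun (f : ∀ w : {w : InfinitePlace L // IsComplex w}, archLocal L N₁ J₁ w × archLocal L N₂ J₂ w) (w : {w : InfinitePlace L // IsComplex w}) => lam w (f w)) :=
    measurable_pi_lambda _ fun w => (hlam w).comp (measurable_pi_apply w)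
  have hspcm : Measurable ⇑(subgroupPiCoords fun w : {w : InfinitePlace L // IsComplex w} => Subgroup.centralizer ({γloc w} : Set (archLocal L (N₁ + N₂) J w))).symm :=
    (subgroupPiHomeomorph fun w : {w : InfinitePlace L // IsComplex w} => Subgroup.centralizer ({γloc w} : Set (archLocal L (N₁ + N₂) J w))).symm.measurable
  have hscm : Measurable ⇑sc := sc.measurable
  -- LHS as a push-forward of `⊗_w (μ₁ w ⊗ μ₂ w)`
  rw [centralizerMeasureOfFrame_def]
  change Measure.map Φ _ = _
  rw [Measure.map_prod_map _ _ hm₁ hm₂, ← map_unshuffle_pi_prod μ₁ μ₂, Measure.map_map hPm measurable_unshuffle, Measure.map_map hΦm (hPm.comp measurable_unshuffle)]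
  -- RHS as a push-forward of `⊗_w (μ₁ w ⊗ μ₂ w)`
  have hθ' : Measure.pi θ = Measure.pi fun w : {w : InfinitePlace L // IsComplex w} => ((μ₁ w).prod (μ₂ w)).map (lam w) := congrArg Measure.pi (funext hθ)
  haveI : ∀ w : {w : InfinitePlace L // IsComplex w}, SigmaFinite (((μ₁ w).prod (μ₂ w)).map (lam w)) := fun w => (hθ w) ▸ (inferInstance : SigmaFinite (θ w))
  rw [hθ', ← Measure.pi_map_pi (fun w => (hlam w).aemeasurable), Measure.map_map hspcm hΛm, Measure.map_map hscm (hspcm.comp hΛm)]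
  -- the two composite maps agree pointwise
  congr 1
  funext f
  apply Subtype.ext
  -- underlying elements of `U(J)(L⁺ ⊗ ℝ)`, compared place by place through `archPiEquivCM`
  have hR : ((sc ((subgroupPiCoords fun w : {w : InfinitePlace L // IsComplex w} => Subgroup.centralizer ({γloc w} : Set (archLocal L (N₁ + N₂) J w))).symm (fun w => lam w (f w))) :
      Subgroup.centralizer ({γ} : Set (arch (↥(maximalRealSubfield L)) L (IsCMField.complexConj L) (N₁ + N₂) J))) : arch (↥(maximalRealSubfield L)) L (IsCMField.complexConj L) (N₁ + N₂) J) =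
      (archPiEquivCM (N₁ + N₂) L J).symm (fun w => ((lam w (f w) : Subgroup.centralizer ({γloc w} : Set (archLocal L (N₁ + N₂) J w))) : archLocal L (N₁ + N₂) J w)) := rfl
  simp only [Function.comp_apply, Prod.map_apply]
  rw [hR, eq_comm, ContinuousMulEquiv.symm_apply_eq]
  funext w
  apply Subtype.ext
  rw [coe_archPiEquivCM_apply]
  have hΦv : ∀ x : arch (↥(maximalRealSubfield L)) L (IsCMField.complexConj L) N₁ J₁ × arch (↥(maximalRealSubfield L)) L (IsCMField.complexConj L) N₂ J₂, ((Φ x : Subgroup.centralizer ({γ} : Set (arch (↥(maximalRealSubfield L)) L (IsCMField.complexConj L) (N₁ + N₂) J))) : arch (↥(maximalRealSubfield L)) L (IsCMField.complexConj L) (N₁ + N₂) J) = archFrameEmbedding T hT x :=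
    fun _ => rfl
  rw [hΦv, map_evalC_archFrameEmbedding, ContinuousMulEquiv.apply_symm_apply, ContinuousMulEquiv.apply_symm_apply]
  rfl

end Product


end UnitaryArchTopForm

end Literature.NumberTheory.Weil1964

end
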